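import Mathlib.LinearAlgebra.Complex.Module
import Mathlib.FieldTheory.Galois.Basic
import Mathlib.GroupTheory.Perm.Fin
import Mathlib.Topology.Instances.ZMod
import Mathlib.Topology.Algebra.Constructions
import Mathlib.CategoryTheory.Discrete.Basic
import Mathlib.Data.ZMod.Basic
import Literature.IUT.HodgeTheaters.ConjugacyIndeterminacies
import Literature.IUT.HodgeTheaters.KappaCoricGalois
import Literature.IUT.HodgeTheaters.ThetaHodgeTheatersRemarksA
import Literature.IUT.HodgeTheaters.ThetaHodgeTheatersRemarksA2
import Mathlib.Analysis.Real.Cardinality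
import Literature.IUT.HodgeTheaters.CoveringsErrata
import HarnessLib

/-!
# FACT-LIST (D-0078 / director-abc (C3)): universal closures of five PARAMETRISED [IUTchI] predicates of
# layer L5 are FALSE — kernel refutations at explicit degenerate data (proof-only)

S. Mochizuki, *Inter-universal Teichmüller theory I*, kurims manuscript (May 2020)
[claim: Mochizuki2012, status: disputed].  The frozen FACT-LIST (plan/FACT-LIST.md, rows F-1959, F-1391,
F-1392, F-1314, F-0751; tranches 186/191/194 of plan/F-TRANCHES.tsv) lists five `def … : Prop` items of
`Literature/IUT/HodgeTheaters/` as «fact-open», i.e. bindable BY NAME as closed assumptions.  Each of them is a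
PREDICATE ON ABSTRACT DATA (a subgroup pair, a subgroup of a topological group, an intermediate field, a pair
of submonoid families, a birational-units record) typing a printed claim about ONE specific object; its
UNIVERSAL CLOSURE («for all data») is false, as the five theorems below show at explicit small data.
Consequence for the bookkeeping: these rows are SCHEMAS — consumable only in instance form at the genuine
object (where the printed claim lives), never as closed facts.  Nothing here bears on the printed claims
themselves (the genuine objects are not the degenerate data used below); no side is taken on [IUTchIII]
Cor. 3.12; typed ≠ proved; refuting a universal closure ≠ refuting print.

* `not_factorizationRigid_perm` — [IUTchI] Rmk 4.5.1 (iii) `Rmk451.FactorizationRigid H J`: false at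
  `G = 𝔖₃`, `H = ⟨(0 1)⟩` (not normal), `J = 1`;
* `not_centerFree_top_zmod_two` — Rmk 3.1.7 (iv) `KappaSolGalois.CenterFree G`: false at the abelian
  group `G = Γ = ℤ/2`;
* `not_kappaSol_centerFree_real_complex` — Rmk 3.1.7 (iv) `KappaSol.CenterFree K Ω M`: false at
  `ℝ ⊆ ℝ ⊆ ℂ` (`Gal(ℂ/ℝ) ≅ ℤ/2` is abelian and nontrivial; Mathlib `Complex.real_algHom_eq_id_or_conj`);
* `not_nearlyAbsolutelyPrimitive_top_bot` — Rmk 3.2.2 `NearlyAbsolutelyPrimitive Φ R`: false at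
  `Φ = ℤ ⊋ R = 0` (one object);
* `exists_not_injectiveAlongLinear` — Rmk 3.2.3 (ii) `InjectiveAlongLinear U`: false at the one-object
  record with units `ℤ/2` and trivial pull-back (a MODEL instance where it holds is abc-iut-L6-t15's
  `S3RemarksLocal.BiratUnits.model_injectiveAlongLinear_*`, `BiratUnitsNonVacuity.lean`).
-/

namespace Literature.IUT.HodgeTheaters

namespace FactListClosureRefutations

open CategoryTheory

/-! ### F-1959 — `Rmk451.FactorizationRigid` ([IUTchI] Rmk 4.5.1 (iii) p.110) -/

/-- In `𝔖₃`, every power of the transposition `(0 1)` fixes `2`. [folklore] -/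
private theorem zpowers_swap_le_stabilizer :
    Subgroup.zpowers (Equiv.swap (0 : Fin 3) 1) ≤ MulAction.stabilizer (Equiv.Perm (Fin 3)) (2 : Fin 3) := by
  rw [Subgroup.zpowers_le, MulAction.mem_stabilizer_iff]
  decide

/-- **F-1959 is a schema, not a fact**: the universal closure of `Rmk451.FactorizationRigid H J`
("a factorization `J ↪ H ↪ G` is uniquely determined by the composite") FAILS at `G = 𝔖₃`,
`H = ⟨(0 1)⟩`, `J = 1`: the second clause would force `H` to be normal, but `(1 2)·H·(1 2)⁻¹ ∋ (0 2) ∉ H`.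
(The printed claim concerns the specific triple of Example 4.5 (i), supplied by Cor. 2.5 — untouched.)
([IUTchI] Rmk 4.5.1 (iii) p.110) [claim: Mochizuki2012, status: disputed] -/
theorem not_factorizationRigid_perm :
    ¬ Rmk451.FactorizationRigid (Subgroup.zpowers (Equiv.swap (0 : Fin 3) 1))
        (⊥ : Subgroup (Equiv.Perm (Fin 3))) := by
  rintro ⟨-, h⟩
  have hH := h (Equiv.swap (1 : Fin 3) 2) bot_le
  -- `(1 2)(0 1)(1 2)⁻¹ ∈ (1 2)·H·(1 2)⁻¹ = H`
  have hmem : (MulAut.conj (Equiv.swap (1 : Fin 3) 2)) (Equiv.swap (0 : Fin 3) 1) ∈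
      Subgroup.zpowers (Equiv.swap (0 : Fin 3) 1) := by
    rw [← hH]
    exact Subgroup.mem_map_of_mem _ (Subgroup.mem_zpowers _)
  have hfix := zpowers_swap_le_stabilizer hmem
  rw [MulAction.mem_stabilizer_iff] at hfix
  exact absurd hfix (by decide)

/-! ### F-1391 — `KappaSolGalois.CenterFree` ([IUTchI] Rmk 3.1.7 (iv) p.69) -/

/-- **F-1391 is a schema, not a fact**: the universal closure of `KappaSolGalois.CenterFree G`
("`Gal(L̄_C/L_C(κ-sol))` is center-free", typed for an arbitrary subgroup `G` of a topological group)
FAILS at `G = Γ = ℤ/2` (abelian and nontrivial, so its center is everything).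
([IUTchI] Rmk 3.1.7 (iv) p.69) [claim: Mochizuki2012, status: disputed] -/
theorem not_centerFree_top_zmod_two :
    ¬ KappaSolGalois.CenterFree (⊤ : Subgroup (Multiplicative (ZMod 2))) := by
  intro h
  unfold KappaSolGalois.CenterFree at h
  have hx : (⟨Multiplicative.ofAdd 1, Subgroup.mem_top _⟩ : (⊤ : Subgroup (Multiplicative (ZMod 2)))) ∈
      Subgroup.center (⊤ : Subgroup (Multiplicative (ZMod 2))) := by
    rw [Subgroup.mem_center_iff]
    intro g
    exact mul_comm g _
  rw [h, Subgroup.mem_bot, Subtype.ext_iff] at hx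
  exact absurd hx (by decide)

/-! ### F-1392 — `KappaSol.CenterFree` ([IUTchI] Rmk 3.1.7 (iv) p.69) -/

/-- Every `ℝ`-algebra automorphism of `ℂ` is the identity or complex conjugation (Mathlib), so any two
commute. [folklore] -/
private theorem complex_algEquiv_comm (σ τ : ℂ ≃ₐ[ℝ] ℂ) : σ * τ = τ * σ := by
  have key : ∀ ρ : ℂ ≃ₐ[ℝ] ℂ, ρ = AlgEquiv.refl ∨ ρ = Complex.conjAe := fun ρ => by
    rcases Complex.real_algHom_eq_id_or_conj (ρ : ℂ →ₐ[ℝ] ℂ) with h | h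
    · exact Or.inl (AlgEquiv.ext fun x => by simpa using congrArg (fun f : ℂ →ₐ[ℝ] ℂ => f x) h)
    · exact Or.inr (AlgEquiv.ext fun x => by simpa using congrArg (fun f : ℂ →ₐ[ℝ] ℂ => f x) h)
  rcases key σ with rfl | rfl <;> rcases key τ with rfl | rfl <;> rfl

/-- **F-1392 is a schema, not a fact**: the universal closure of `KappaSol.CenterFree K Ω M`
(`Z(Gal(Ω/M)) = 1`, typed for an arbitrary tower `K ⊆ M ⊆ Ω`) FAILS at `ℝ ⊆ ℝ ⊆ ℂ`: `Gal(ℂ/ℝ) = {1, conj}` is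
abelian and nontrivial, so its center is the whole group.  (Print's instance is `L_C ⊆ L_C(κ-sol) ⊆ L̄_C`,
via Lemma 2.7 (vi)(vii) and [NodNon] Thm. C — untouched.) ([IUTchI] Rmk 3.1.7 (iv) p.69)
[claim: Mochizuki2012, status: disputed] -/
theorem not_kappaSol_centerFree_real_complex : ¬ KappaSol.CenterFree ℝ ℂ (⊥ : IntermediateField ℝ ℂ) := by
  intro h
  unfold KappaSol.CenterFree at h
  have hmem : Complex.conjAe ∈ (⊥ : IntermediateField ℝ ℂ).fixingSubgroup := by
    rw [IntermediateField.fixingSubgroup_bot]; exact Subgroup.mem_top _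
  have hc : (⟨Complex.conjAe, hmem⟩ : (⊥ : IntermediateField ℝ ℂ).fixingSubgroup) ∈
      Subgroup.center ((⊥ : IntermediateField ℝ ℂ).fixingSubgroup) := by
    rw [Subgroup.mem_center_iff]
    intro g
    exact Subtype.ext (complex_algEquiv_comm _ _)
  rw [h, Subgroup.mem_bot, Subtype.ext_iff] at hc
  have hc' : Complex.conjAe = 1 := hc
  have hI : ((starRingEnd ℂ) Complex.I).im = Complex.I.im := by
    have := congrArg (fun σ : ℂ ≃ₐ[ℝ] ℂ => (σ Complex.I).im) hc'
    simpa [Complex.conjAe_coe] using this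
  rw [Complex.conj_im, Complex.I_im] at hI
  norm_num at hI

/-! ### F-1314 — `NearlyAbsolutelyPrimitive` ([IUTchI] Rmk 3.2.2 p.74) -/

/-- **F-1314 is a schema, not a fact**: the universal closure of `NearlyAbsolutelyPrimitive Φ R` ("ONE
positive integer `N` with `Φ(A)^N ⊆ R(A)` at every object") FAILS at one object with `Φ = ℤ`, `R = 0`
(no power of `1 ∈ ℤ` is `0`).  (Print's instance: `Φ_{𝒞⊢_v} = ℕ·log(q̲_v)` against `Λ·ord(ℚ_p^×)`,
[FrdII] Ex. 1.1 (ii) — untouched.) ([IUTchI] Rmk 3.2.2 p.74) [claim: Mochizuki2012, status: disputed] -/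
theorem not_nearlyAbsolutelyPrimitive_top_bot :
    ¬ NearlyAbsolutelyPrimitive (Obj := Unit) (ι := fun _ => Multiplicative ℤ)
        (fun _ => ⊤) (fun _ => ⊥) := by
  rintro ⟨N, hN, h⟩
  have h1 := h () (Multiplicative.ofAdd (1 : ℤ)) (Submonoid.mem_top _)
  rw [Submonoid.mem_bot] at h1
  have h2 := congrArg Multiplicative.toAdd h1
  rw [toAdd_pow, toAdd_ofAdd, toAdd_one, nsmul_eq_mul, mul_one] at h2
  omega

/-! ### F-0751 — `InjectiveAlongLinear` ([IUTchI] Rmk 3.2.3 (ii) p.76) -/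

/-- **F-0751 is a schema, not a fact**: the universal closure of `InjectiveAlongLinear U` ("along a LINEAR
morphism the pull-back of birational units is injective", typed for an arbitrary record `U`) FAILS at the
one-object discrete category with units `ℤ/2` and the TRIVIAL homomorphism as pull-back along the
identity (declared linear).  A model instance where it HOLDS is abc-iut-L6-t15's
`S3RemarksLocal.BiratUnits.model_injectiveAlongLinear_of_injective` at the [FrdI] Thm 5.2 model
Frobenioid (`BiratUnitsNonVacuity.lean`). ([IUTchI] Rmk 3.2.3 (ii) p.76) [claim: Mochizuki2012, status: disputed] -/
theorem exists_not_injectiveAlongLinear :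
    ∃ U : S3RemarksLocal.BiratUnits.{0, 0, 0} (Discrete PUnit), ¬ InjectiveAlongLinear U := by
  refine ⟨{ IsLinear := fun _ => True
            units := fun _ => Multiplicative (ZMod 2)
            pull := fun _ => 1 }, fun h => ?_⟩
  have hinj : Function.Injective (1 : Multiplicative (ZMod 2) →* Multiplicative (ZMod 2)) :=
    h (𝟙 (Discrete.mk PUnit.unit)) trivial
  have h01 := @hinj (Multiplicative.ofAdd 0) (Multiplicative.ofAdd 1) rfl
  exact absurd (congrArg Multiplicative.toAdd h01) (by decide)

/-! ### F-1979 — `TameGaloisCountable` ([IUTchI] Rmk 2.5.3 (vi) p.56): an uncountable power of `ℤ/2` is a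
profinite group that is NOT second countable -/

/-- **An uncountable product of copies of `ℤ/2` is not second countable** (it is not even first countable
at `1`: a countable family of neighbourhoods of `1` constrains only countably many coordinates). [folklore] -/
private theorem not_secondCountableTopology_pi {I : Type} (hI : ¬ (Set.univ : Set I).Countable) :
    ¬ SecondCountableTopology (I → Multiplicative (ZMod 2)) := by
  classical
  intro h
  obtain ⟨u, hu⟩ := (nhds (1 : I → Multiplicative (ZMod 2))).exists_antitone_basis
  let y : I → Multiplicative (ZMod 2) := fun _ => Multiplicative.ofAdd 1
  choose F hF using fun n => exists_finset_piecewise_mem_of_mem_nhds (hu.mem n) y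
  have hcount : (⋃ n, (F n : Set I)).Countable := Set.countable_iUnion fun n => (F n).countable_toSet
  obtain ⟨i, hi⟩ : ∃ i, i ∉ ⋃ n, (F n : Set I) := by
    by_contra hall
    exact hI (hcount.mono fun i _ => not_not.1 fun hi => hall ⟨i, hi⟩)
  have hU : {f : I → Multiplicative (ZMod 2) | f i ∈ ({1} : Set (Multiplicative (ZMod 2)))} ∈
      nhds (1 : I → Multiplicative (ZMod 2)) :=
    ((isOpen_discrete _).preimage (continuous_apply i)).mem_nhds rfl
  obtain ⟨n, -, hn⟩ := hu.1.mem_iff.1 hU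
  have hmem := hn (hF n)
  have hiF : i ∉ F n := fun hin => hi (Set.mem_iUnion.2 ⟨n, hin⟩)
  have hval : (F n).piecewise 1 y i = y i := by
    unfold Finset.piecewise
    exact if_neg hiF
  rw [Set.mem_setOf_eq, hval, Set.mem_singleton_iff] at hmem
  exact absurd hmem (by decide)

/-- **F-1979 is a schema, not a fact**: the universal closure of `TameGaloisCountable E`
("`G` second countable ⇒ `Π` second countable", typed for an ARBITRARY extension `1 → Δ → Π → G → 1` of
profinite groups) FAILS at the split extension `Π := (ℤ/2)^ℝ ↠ G := 1`: `G` is finite, `Π` is a profinite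
group that is not second countable (`not_secondCountableTopology_pi`, `ℝ` uncountable).  Print's instance —
`Π` an open subgroup of the TOPOLOGICALLY FINITELY GENERATED `π̂₁` of a curve, [IUTchI] Rmk 2.5.3 (vi) —
is untouched. ([IUTchI] Rmk 2.5.3 (vi) p.56) [claim: Mochizuki2012, status: disputed] -/
theorem not_tameGaloisCountable_pow :
    ¬ Rmk253.TameGaloisCountable
        ⟨ProfiniteGrp.of (ℝ → Multiplicative (ZMod 2)), ProfiniteGrp.of (Multiplicative (ZMod 1)),
          { toMonoidHom := 1, continuous_toFun := continuous_const },
          fun _ => ⟨1, Subsingleton.elim _ _⟩⟩ := by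
  intro h
  have hG : SecondCountableTopology (ProfiniteGrp.of (Multiplicative (ZMod 1))) :=
    Finite.toSecondCountableTopology
  exact not_secondCountableTopology_pi Cardinal.not_countable_real (h hG)


end FactListClosureRefutations

end Literature.IUT.HodgeTheaters

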